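import Literature.Combinatorics.Sahi2008.UniformSquare
import Literature.Combinatorics.Sahi2008.TotalOrder
import HarnessLib

/-!
# Lieb–Sahi (2022), §3.4: the `n`-function inequality on the square, discrete form (all orders)

Topic `Literature/Combinatorics/Sahi2008` (sequel of `UniformSquare.lean`, which did the case `n = 3` =
[LiebSahi2021, §2]; vocabulary from `Functional.lean` — `sahiE`, `ex`, `SahiPositive`; `Indicators.lean` —
`setInd`, the layer cake `sahiPositive_iff_indicators`; `Multilinear.lean` — linearity in each slot;
`Symmetry.lean` — `sahiE_comp_perm`; `TotalOrder.lean` — `E_n ≥ 0` for nested events; `UniformSquare.lean` —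
the staircase sequences `𝒜(m)` (`IsStair`), the perturbations `a⁻, a⁺, a⋆` (`aMinus`, `aPlus`, `aStar`),
Lemma 2.5 (`S_aPlus_add_S_aMinus`), Lemma 2.7 (`aStar_inf_eq`), the grid `Fin m × Fin m` with its uniform weight
`gridWeight m` and the dictionary `a ↦ S_a` (`stairSet`)).

## Source (read 2026-08-19 from the materialised arXiv text, corpus `paper:arxiv-2107.09838`, pp. 7–9)

E. H. Lieb, S. Sahi, *On the extension of the FKG inequality to `n` functions*, J. Math. Phys. **63** (2022)
043301 = arXiv:2107.09838 [LiebSahi2021], Section 3.4 "Proof of the `n` function inequality in two dimensions":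

> "**THEOREM 3.7.** If `f^1,…,f^n` are positive and monotone on `[0,1]^2` then `E_n(f^1,…,f^n) ≥ 0`."
> "As before we can deduce this from the special case of `χ_a` as in (2.6).
> **LEMMA 3.8.** It suffices to prove Theorem 3.7 for `χ_{a^1},…,χ_{a^n}`, `a^i ∈ 𝒜(m)`, for all `m`."
> "We shall prove the next three theorems together by induction on `n`.
> **THEOREM 3.11.** If `a^1,…,a^{n−2}, b` are in `𝒜`; `S` is a subset of `Q_2`; and `χ_b χ_S = 0`, then
> `E_n(χ_{a^1},…,χ_{a^{n−2}},χ_b,χ_S) ≤ 0`.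
> **THEOREM 3.12.** If `a^1,…,a^{n−2}, b, c` are in `𝒜`; `b, c` have descent at `i`; and `b_{i+1} ≤ c_{i+1}` then
> `E_n(a^1,…,a^{n−2},b,c⋆) ≤ E_n(a^1,…,a^{n−2},b,c)`.
> **THEOREM 3.13.** For all `a^1,…,a^n` in `𝒜` we have `E_n(a^1,…,a^n) ≥ 0`."

(`𝒜 = 𝒜(m)` = decreasing `m`-tuples of integers in `[0, m]`, encoding the staircases `S_a` of the `m × m` grid
`Q_2`; `E` = the uniform probability measure on the grid; `a⁻, a⁺, a⋆` the perturbations (2.10) of a sequence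
with a descent `a_i > a_{i+1}`.)

## The printed proof and how it is mirrored (same order; `A(n)`, `B(n)`, `C(n)` as on p. 8)

* **Proposition 3.10** ("`2E_n(a^1,…,a^{n−1},a) = E_n(…,a⁺) + E_n(…,a⁻)` if `a` has descent at `i` but the
  others do not; proved for each term `E_σ` … by applying Lemma 2.5 to the unique factor of `E_σ` involving
  `a`") — `sahiE_update_aPlus_add_aMinus`.  Since the tree DEFINES `E_n` by the Lieb–Sahi recursion (Prop. 3.3)
  rather than by the cycle sum (Def. 3.1), "termwise in `E_σ`" is replaced by the equivalent principle that
  `E_n(f_0,…,f_{n−1})` only depends on the joint moments `E(Π_{i∈S} f_i)` (`sahiE_congr_of_moments`, proved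
  along the recursion) plus linearity in the slot (`Multilinear.lean`): `sahiE_update_add_eq_two_mul`.
  Lemma 2.5 itself is `UniformSquare.S_aPlus_add_S_aMinus`.
* **Theorem 3.11 = `A(n)`**, proved from `A(n−1) ∧ C(n−1)` exactly as printed: peel `χ_S` with Prop. 3.3
  (`sahiE_succ_succ`): `e_i ≤ 0` by `A(n−1)` (the slot `χ_{a^i}` becomes `χ_{S ∩ S_{a^i}}`, again disjoint from
  `S_b`), `e_{n−1} = E_{n−1}(…,0) = 0` (`sahiE_update_zero`), `e_n ≥ 0` by `C(n−1)` — `disjoint_nonpos_succ`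
  (with the slots of `χ_b`, `χ_S` arbitrary, the bookkeeping "by symmetry" being `sahiE_comp_perm`); base
  `A(2)`: `E_2(χ_b, χ_S) = −E(χ_b)E(χ_S) ≤ 0` — `disjoint_nonpos_zero`.
* **`A(n) ⟹ B(n)`** (Theorem 3.12): `χ_{c⋆} − χ_c = χ_S` with `S = S_{c⋆} ∖ S_c`, and `χ_S χ_b = χ_{c⋆b} − χ_{cb}
  = 0` by Lemma 2.7 — `sahiE_update_aStar_le`.
* **`B(n) ⟹ C(n)`** (Theorem 3.13): minimise `E_n` over `𝒜^n`, then maximise `λ = E(a^1) + ⋯ + E(a^n)` among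
  the minimisers; if some `a^k` has a descent at `i` then either no other sequence has (Prop. 3.10: `a⁺` is
  again a minimiser with larger `λ`) or another one `b` has (Thm. 3.12: star the one with the larger
  `(i+1)`-entry) — contradiction; so every `a^k` is constant, the staircases are nested, and `E_n ≥ 0` by the
  chain case (Prop. 3.9; in the tree `sahiE_setInd_nonneg_of_total` = Blinovsky's Lemma 1 / LS22 Lemma 3.2) —
  `stairPos_of_disjointNonpos`.
* The induction `A(n−1) ∧ C(n−1) ⟹ A(n)`, `A(n) ⟹ B(n) ⟹ C(n)` — `disjointNonpos_and_stairPos`; Theorem 3.13 —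
  `liebSahi_thm313`; Theorem 3.11 — `liebSahi_thm311`; Theorem 3.12 — `liebSahi_thm312`.
* Transport (Lemma 3.8 = layer cake + "any monotone union of little squares is an `S_a`", and the reflection
  `x ↦ 1 − x` of [LiebSahi2021, §2]): `E_n ≥ 0` for the indicators of any `n` down-sets / up-sets of the grid and
  **Sahi positivity OF EVERY ORDER of the uniform weight on the square grid** — `sahiPositive_uniformGrid` —
  i.e. [LiebSahi2021, Thm. 3.7] with Lebesgue measure on `[0,1]²` replaced by the uniform probability measure on
  the `m × m` grid, `m ≥ 1` (their `L¹`-limit passage Lemma 2.3/3.8 to the continuum is not formalised; as in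
  `UniformSquare.lean` this is a documented restriction, not a change of the argument).

Everything here is PROVED; no named facts; axioms standard.  Motivation (this programme, crux
`stmt-CriticalPhenomena-4575`, cell prim-sahi): with this file every case of Sahi's Conjecture 5 that is PROVED
in print on a finite structure — cumulations (Sahi Thm. 2), `|X| ≤ 2` (Sahi Prop. 15), chains (Blinovsky 2013),
and the square for ALL `n` (Lieb–Sahi Thm. 3.7/3.13) — is a tree theorem.
-/

noncomputable section

namespace Literature.Combinatorics.Sahi2008

open Finset Function

variable {α : Type*} [Fintype α]

/-! ### `E_n` only sees the joint moments `E(Π_{i∈S} f_i)` -/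

/-- Products over the tail of a family are products of the family over the shifted index set (plumbing).
[folklore] -/
private theorem prod_tail_eq_prod_map {γ : Type*} {n : ℕ} (F : Fin (n + 2) → γ → ℝ) (S : Finset (Fin (n + 1))) :
    ∏ j ∈ S, Fin.tail F j = ∏ j ∈ S.map (Fin.succEmb (n + 1)), F j := by
  rw [prod_map]
  rfl

/-- `0` is not a successor (plumbing). [folklore] -/
private theorem zero_notMem_map_succEmb {n : ℕ} (S : Finset (Fin (n + 1))) :
    (0 : Fin (n + 2)) ∉ S.map (Fin.succEmb (n + 1)) := by
  rw [Finset.mem_map]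
  rintro ⟨a, _, ha⟩
  exact Fin.succ_ne_zero a ha

/-- The product over `S ∋ i` of the tail family with slot `i` multiplied by the head is the product of the
original family over `{0} ∪ (S+1)` (plumbing for the recursion). [folklore] -/
private theorem prod_update_tail_mul_head {γ : Type*} {n : ℕ} (F : Fin (n + 2) → γ → ℝ)
    {S : Finset (Fin (n + 1))} {i : Fin (n + 1)} (hi : i ∈ S) :
    ∏ j ∈ S, update (Fin.tail F) i (Fin.tail F i * F 0) j =
      ∏ j ∈ insert (0 : Fin (n + 2)) (S.map (Fin.succEmb (n + 1))), F j := by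
  rw [prod_update_of_mem hi, sdiff_singleton_eq_erase, mul_comm (Fin.tail F i) (F 0), mul_assoc,
    mul_prod_erase S (Fin.tail F) hi, prod_insert (zero_notMem_map_succEmb S), prod_tail_eq_prod_map]

/-- **`E_n` depends on `(f_0,…,f_{n−1})` only through the joint moments `E(Π_{i∈S} f_i)`, `∅ ≠ S ⊆ [n]`**:
two families (possibly under two weights, on two spaces) with the same joint moments have the same `E_n`.
This is manifest in Sahi's definition `E_n = Σ_σ (−1)^{C_σ−1} E_σ` (each `E_σ` is a product of joint moments)
and is proved here for the tree's recursive definition, along the recursion. [cite: LiebSahi2021, Def. 3.1 and Prop. 3.3] -/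
theorem sahiE_congr_of_moments {β : Type*} [Fintype β] (μ : α → ℝ) (ν : β → ℝ) :
    ∀ (n : ℕ) (f : Fin n → α → ℝ) (g : Fin n → β → ℝ),
      (∀ S : Finset (Fin n), S.Nonempty → ex μ (∏ i ∈ S, f i) = ex ν (∏ i ∈ S, g i)) →
      sahiE μ n f = sahiE ν n g
  | 0, f, g, _ => by rw [sahiE_zero, sahiE_zero]
  | 1, f, g, h => by
    rw [sahiE_one_apply, sahiE_one_apply]
    have h0 := h {0} ⟨0, mem_singleton_self 0⟩
    simpa only [prod_singleton] using h0
  | n + 2, f, g, h => by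
    rw [sahiE_succ_succ, sahiE_succ_succ]
    have h0 : ex μ (f 0) = ex ν (g 0) := by
      have h0 := h {0} ⟨0, mem_singleton_self 0⟩
      simpa only [prod_singleton] using h0
    have htail : ∀ S : Finset (Fin (n + 1)), S.Nonempty →
        ex μ (∏ i ∈ S, Fin.tail f i) = ex ν (∏ i ∈ S, Fin.tail g i) := by
      intro S hS
      rw [prod_tail_eq_prod_map, prod_tail_eq_prod_map]
      exact h _ (Finset.map_nonempty.2 hS)
    have hupd : ∀ (i : Fin (n + 1)) (S : Finset (Fin (n + 1))), S.Nonempty →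
        ex μ (∏ j ∈ S, update (Fin.tail f) i (Fin.tail f i * f 0) j) =
          ex ν (∏ j ∈ S, update (Fin.tail g) i (Fin.tail g i * g 0) j) := by
      intro i S hS
      by_cases hi : i ∈ S
      · rw [prod_update_tail_mul_head f hi, prod_update_tail_mul_head g hi]
        exact h _ (insert_nonempty _ _)
      · rw [prod_update_of_notMem hi, prod_update_of_notMem hi]
        exact htail S hS
    rw [h0, sahiE_congr_of_moments μ ν (n + 1) (Fin.tail f) (Fin.tail g) htail]
    congr 1
    exact sum_congr rfl fun i _ => sahiE_congr_of_moments μ ν (n + 1) _ _ (hupd i)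

/-- One-slot form: if `E(u·Π_{i∈S} f_i) = E(v·Π_{i∈S} f_i)` for every `S ∌ k`, then replacing slot `k` by `u`
or by `v` gives the same `E_n`. [cite: LiebSahi2021, Def. 3.1 and Prop. 3.3] -/
theorem sahiE_update_congr_of_moments (μ : α → ℝ) {n : ℕ} (f : Fin n → α → ℝ) (k : Fin n) {u v : α → ℝ}
    (h : ∀ S : Finset (Fin n), k ∉ S → ex μ (u * ∏ i ∈ S, f i) = ex μ (v * ∏ i ∈ S, f i)) :
    sahiE μ n (update f k u) = sahiE μ n (update f k v) := by
  refine sahiE_congr_of_moments μ μ n _ _ fun S _ => ?_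
  by_cases hk : k ∈ S
  · rw [prod_update_of_mem hk, prod_update_of_mem hk]
    exact h (S \ {k}) (by simp)
  · rw [prod_update_of_notMem hk, prod_update_of_notMem hk]

/-- **The averaging principle behind Proposition 3.10**: if `E(u·d) + E(v·d) = 2E(w·d)` for every product `d`
of the other slots, then `E_n(…,u,…) + E_n(…,v,…) = 2E_n(…,w,…)` (Lieb–Sahi: "each term of `E_σ` has a unique
factor involving `a`", Prop. 2.6 / Prop. 3.10; here via linearity in the slot and `sahiE_update_congr_of_moments`).
[cite: LiebSahi2021, Prop. 2.6 and Prop. 3.10] -/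
theorem sahiE_update_add_eq_two_mul (μ : α → ℝ) {n : ℕ} (f : Fin n → α → ℝ) (k : Fin n) {u v w : α → ℝ}
    (h : ∀ S : Finset (Fin n), k ∉ S →
      ex μ (u * ∏ i ∈ S, f i) + ex μ (v * ∏ i ∈ S, f i) = 2 * ex μ (w * ∏ i ∈ S, f i)) :
    sahiE μ n (update f k u) + sahiE μ n (update f k v) = 2 * sahiE μ n (update f k w) := by
  rw [← sahiE_update_add, ← sahiE_update_smul]
  refine sahiE_update_congr_of_moments μ f k fun S hS => ?_
  rw [add_mul, ex_add, smul_mul_assoc, ex_smul]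
  exact h S hS

namespace LiebSahiGrid

variable {m : ℕ}

/-! ### More on staircases: constants, infima, products of indicators -/

/-- The full staircase: `S_{(m,…,m)} = Q_2`. [cite: LiebSahi2021, eq. (2.6)] -/
theorem stairSet_const_self : stairSet (fun _ : Fin m => m) = univ := by
  ext p
  simp only [mem_stairSet, mem_univ, iff_true]
  exact p.2.isLt

/-- `χ_{Q_2} = 1`. [folklore] -/
private theorem setInd_univ_eq_one : setInd (univ : Finset (Fin m × Fin m)) = 1 := by
  funext x
  simp [setInd_apply]

/-- `χ_∅ = 0`. [folklore] -/
private theorem setInd_empty_eq_zero {β : Type*} [DecidableEq β] : setInd (∅ : Finset β) = 0 := by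
  funext x
  simp [setInd_apply]

/-- Constant sequences are staircases. [cite: LiebSahi2021, Prop. 3.9] -/
theorem isStair_const {c : ℕ} (hc : c ≤ m) : IsStair m (fun _ : Fin m => c) :=
  ⟨fun _ _ _ => le_rfl, fun _ => hc⟩

/-- `𝒜(m)` is closed under the product `(ab)_i = min{a_i, b_i}`. [cite: LiebSahi2021, eq. (2.6)] -/
theorem isStair_inf {a b : Fin m → ℕ} (ha : IsStair m a) (hb : IsStair m b) : IsStair m (a ⊓ b) :=
  ⟨fun _ _ h => inf_le_inf (ha.1 h) (hb.1 h), fun i => inf_le_left.trans (ha.2 i)⟩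

/-- `S_a ⊆ S_b` when `a ≤ b` entrywise. [cite: LiebSahi2021, eq. (2.6)] -/
theorem stairSet_mono {a b : Fin m → ℕ} (h : ∀ i, a i ≤ b i) : stairSet a ⊆ stairSet b := by
  intro p hp
  rw [mem_stairSet] at hp ⊢
  exact lt_of_lt_of_le hp (h p.1)

/-- "`E(f^{i_1} ⋯ f^{i_p})`": a product of staircase indicators is the indicator of a staircase (the entrywise
minimum), which has no descent wherever none of the factors has. [cite: LiebSahi2021, §2.1 (χ_{ab} = χ_a χ_b) and Lemma 2.5] -/
theorem exists_stair_prod_eq {ι : Type*} [DecidableEq ι] (T : Finset ι) (a : ι → Fin m → ℕ)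
    (ha : ∀ i ∈ T, IsStair m (a i)) :
    ∃ d : Fin m → ℕ, IsStair m d ∧ (∏ i ∈ T, setInd (stairSet (a i))) = setInd (stairSet d) ∧
      ∀ j j' : Fin m, (∀ i ∈ T, a i j = a i j') → d j = d j' := by
  induction T using Finset.induction_on with
  | empty =>
    refine ⟨fun _ => m, isStair_const le_rfl, ?_, fun _ _ _ => rfl⟩
    rw [prod_empty, stairSet_const_self, setInd_univ_eq_one]
  | insert i T hiT ih =>
    obtain ⟨d, hd, hprod, hflat⟩ := ih fun i' hi' => ha i' (mem_insert_of_mem hi')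
    refine ⟨a i ⊓ d, isStair_inf (ha i (mem_insert_self i T)) hd, ?_, fun j j' hjj' => ?_⟩
    · rw [prod_insert hiT, hprod, setInd_mul, ← stairSet_inf]
    · simp only [Pi.inf_apply]
      rw [hjj' i (mem_insert_self i T), hflat j j' fun i' hi' => hjj' i' (mem_insert_of_mem hi')]

/-- `E(χ_a χ_d) = S(ad)/m²`. [cite: LiebSahi2021, eqs. (2.6)–(2.7)] -/
theorem ex_setInd_stairSet_mul (a d : Fin m → ℕ) (ha : ∀ i, a i ≤ m) :
    ex (gridWeight m) (setInd (stairSet a) * setInd (stairSet d)) = S (a ⊓ d) / (m : ℝ) ^ 2 := by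
  rw [setInd_mul, ← stairSet_inf, ex_setInd_stairSet (a := a ⊓ d) (fun i => inf_le_left.trans (ha i))]

/-- Replacing the sequence in slot `k` replaces the indicator in slot `k` (plumbing). [folklore] -/
private theorem setInd_stairSet_update {n : ℕ} (x : Fin n → Fin m → ℕ) (k : Fin n) (z : Fin m → ℕ) :
    (fun i => setInd (stairSet (update x k z i))) =
      update (fun i => setInd (stairSet (x i))) k (setInd (stairSet z)) := by
  funext i
  exact apply_update (fun _ (y : Fin m → ℕ) => setInd (stairSet y)) x k z i

/-- A family with one sequence replaced by a staircase is a family of staircases (plumbing). [folklore] -/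
private theorem isStair_update {n : ℕ} {x : Fin n → Fin m → ℕ} (hx : ∀ i, IsStair m (x i)) (k : Fin n)
    {z : Fin m → ℕ} (hz : IsStair m z) (i : Fin n) : IsStair m (update x k z i) := by
  by_cases hi : i = k
  · subst hi
    rw [update_self]
    exact hz
  · rw [update_of_ne hi]
    exact hx i

/-- `λ(a^1,…,a^n) = Σ E(a^i)` changes by `S(z) − S(x_k)` when slot `k` is replaced by `z` (plumbing for the
extremal argument). [folklore] -/
private theorem sum_S_update {n : ℕ} (x : Fin n → Fin m → ℕ) (k : Fin n) (z : Fin m → ℕ) :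
    ∑ i, S (update x k z i) = ∑ i, S (x i) + (S z - S (x k)) := by
  have h : ∑ i, (S (update x k z i) - S (x i)) = S z - S (x k) := by
    rw [Finset.sum_eq_single k]
    · rw [update_self]
    · intro j _ hjk
      rw [update_of_ne hjk, sub_self]
    · intro hk
      exact absurd (mem_univ k) hk
  rw [sum_sub_distrib] at h
  linarith

/-! ### Proposition 3.10: averaging over `a⁺, a⁻` -/

/-- **Proposition 3.10.** If `a = a^k` has descent at `i` but the other sequences of the family do not, then
`E_n(…,a⁺,…) + E_n(…,a⁻,…) = 2E_n(…,a,…)` (uniform weight on the `m × m` grid, staircase indicators).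
[cite: LiebSahi2021, Prop. 3.10 (and Prop. 2.6, Lemma 2.5)] -/
theorem sahiE_update_aPlus_add_aMinus {n : ℕ} {a : Fin n → Fin m → ℕ} (ha : ∀ i, IsStair m (a i))
    (k : Fin n) {p : ℕ} (hp : p + 1 < m) (hflat : ∀ i, i ≠ k → a i (ixL hp) = a i (ixR hp)) :
    sahiE (gridWeight m) n (update (fun i => setInd (stairSet (a i))) k (setInd (stairSet (aPlus (a k) hp)))) +
      sahiE (gridWeight m) n
        (update (fun i => setInd (stairSet (a i))) k (setInd (stairSet (aMinus (a k) hp)))) =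
      2 * sahiE (gridWeight m) n (fun i => setInd (stairSet (a i))) := by
  classical
  have hself : (fun i => setInd (stairSet (a i))) =
      update (fun i => setInd (stairSet (a i))) k (setInd (stairSet (a k))) := by
    rw [update_eq_self]
  conv_rhs => rw [hself]
  refine sahiE_update_add_eq_two_mul _ _ k fun T hkT => ?_
  obtain ⟨d, _, hprod, hdflat⟩ := exists_stair_prod_eq T a (fun i _ => ha i)
  have hdp : d (ixL hp) = d (ixR hp) :=
    hdflat _ _ fun i hi => hflat i (ne_of_mem_of_not_mem hi hkT)
  rw [hprod, ex_setInd_stairSet_mul _ _ (isStair_aPlus hp (ha k)).2,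
    ex_setInd_stairSet_mul _ _ (isStair_aMinus hp (ha k)).2, ex_setInd_stairSet_mul _ _ (ha k).2, ← add_div,
    S_aPlus_add_S_aMinus hp hdp, mul_div_assoc]

/-! ### Theorem 3.11 (`A(n)`): one slot disjoint from a staircase slot -/

/-- `A(2)`: `E_2(χ_b, χ_S) = −E(χ_b)E(χ_S) ≤ 0` when `χ_b χ_S = 0` (the base of the induction; in the paper
`A(1)` is vacuous and `A(2)` is the first instance of the step). [cite: LiebSahi2021, Thm. 3.11 (proof, case n = 2)] -/
theorem disjoint_nonpos_zero (F : Fin 2 → Fin m × Fin m → ℝ) (s t : Fin 2) (hst : s ≠ t) (b : Fin m → ℕ)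
    (T : Finset (Fin m × Fin m)) (hbT : Disjoint (stairSet b) T) (hs : F s = setInd (stairSet b))
    (ht : F t = setInd T) : sahiE (gridWeight m) 2 F ≤ 0 := by
  classical
  have hμ := fun x => (show (0 : ℝ) ≤ gridWeight m x by unfold gridWeight; positivity)
  have hprod : F 0 * F 1 = 0 := by
    have h01 : (s = 0 ∧ t = 1) ∨ (s = 1 ∧ t = 0) := by
      rcases Fin.eq_zero_or_eq_succ s with hs0 | ⟨s', hs'⟩ <;>
        rcases Fin.eq_zero_or_eq_succ t with ht0 | ⟨t', ht'⟩
      · exact absurd (hs0.trans ht0.symm) hst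
      · left
        exact ⟨hs0, by rw [ht', Subsingleton.elim t' 0]; rfl⟩
      · right
        exact ⟨by rw [hs', Subsingleton.elim s' 0]; rfl, ht0⟩
      · exfalso
        apply hst
        rw [hs', ht', Subsingleton.elim s' t']
    have hbT' : stairSet b ∩ T = ∅ := Finset.disjoint_iff_inter_eq_empty.1 hbT
    rcases h01 with ⟨rfl, rfl⟩ | ⟨rfl, rfl⟩
    · rw [hs, ht, setInd_mul, hbT', setInd_empty_eq_zero]
    · rw [hs, ht, mul_comm, setInd_mul, hbT', setInd_empty_eq_zero]
  rw [sahiE_two_apply, hprod]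
  have h0 : (0 : ℝ) ≤ ex (gridWeight m) (F 0) := by
    rcases Fin.eq_zero_or_eq_succ s with hs0 | ⟨s', hs'⟩
    · rw [← hs0, hs]; exact ex_nonneg hμ fun x => setInd_nonneg _ _
    · have ht0 : t = 0 := by
        rcases Fin.eq_zero_or_eq_succ t with ht0 | ⟨t', ht'⟩
        · exact ht0
        · exfalso; apply hst; rw [hs', ht', Subsingleton.elim s' t']
      rw [← ht0, ht]; exact ex_nonneg hμ fun x => setInd_nonneg _ _
  have h1 : (0 : ℝ) ≤ ex (gridWeight m) (F 1) := by
    rcases Fin.eq_zero_or_eq_succ s with hs0 | ⟨s', hs'⟩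
    · have ht1 : t = 1 := by
        rcases Fin.eq_zero_or_eq_succ t with ht0 | ⟨t', ht'⟩
        · exact absurd (hs0.trans ht0.symm) hst
        · rw [ht', Subsingleton.elim t' 0]; rfl
      rw [← ht1, ht]; exact ex_nonneg hμ fun x => setInd_nonneg _ _
    · have hs1 : s = 1 := by rw [hs', Subsingleton.elim s' 0]; rfl
      rw [← hs1, hs]; exact ex_nonneg hμ fun x => setInd_nonneg _ _
  have hex0 : ex (gridWeight m) (0 : Fin m × Fin m → ℝ) = 0 := by simp [ex]
  rw [hex0]
  nlinarith [mul_nonneg h0 h1]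

/-- **The step `A(n−1) ∧ C(n−1) ⟹ A(n)`** of [LiebSahi2021, Thm. 3.11], with the disjoint pair of slots in
arbitrary positions `s ≠ t`: peel `χ_S` (slot `t`, moved to the front by the symmetry of `E_n`) with the
Lieb–Sahi recursion; the term where `χ_S` meets `χ_b` vanishes (`χ_b χ_S = 0`), the terms where it meets
`χ_{a^i}` are `≤ 0` by `A(n−1)` (`χ_{a^i} χ_S = χ_{S ∩ S_{a^i}}` is again disjoint from `S_b`), and the last term
is `−E_{n−1}(staircases)·E(χ_S) ≤ 0` by `C(n−1)`. [cite: LiebSahi2021, Thm. 3.11 (proof)] -/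
theorem disjoint_nonpos_succ (k : ℕ)
    (hC : ∀ a : Fin (k + 2) → Fin m → ℕ, (∀ i, IsStair m (a i)) →
      0 ≤ sahiE (gridWeight m) (k + 2) (fun i => setInd (stairSet (a i))))
    (hA : ∀ (F : Fin (k + 2) → Fin m × Fin m → ℝ) (s t : Fin (k + 2)), s ≠ t → ∀ (b : Fin m → ℕ)
      (T : Finset (Fin m × Fin m)), IsStair m b → Disjoint (stairSet b) T → F s = setInd (stairSet b) →
      F t = setInd T → (∀ i, i ≠ s → i ≠ t → ∃ a, IsStair m a ∧ F i = setInd (stairSet a)) →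
      sahiE (gridWeight m) (k + 2) F ≤ 0)
    (F : Fin (k + 3) → Fin m × Fin m → ℝ) (s t : Fin (k + 3)) (hst : s ≠ t) (b : Fin m → ℕ)
    (T : Finset (Fin m × Fin m)) (hb : IsStair m b) (hbT : Disjoint (stairSet b) T)
    (hs : F s = setInd (stairSet b)) (ht : F t = setInd T)
    (hrest : ∀ i, i ≠ s → i ≠ t → ∃ a, IsStair m a ∧ F i = setInd (stairSet a)) :
    sahiE (gridWeight m) (k + 3) F ≤ 0 := by
  classical
  have hμ := fun x => (show (0 : ℝ) ≤ gridWeight m x by unfold gridWeight; positivity)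
  -- First the case `t = 0` (the recursion peels slot `0`).
  have main : ∀ (G : Fin (k + 3) → Fin m × Fin m → ℝ) (s : Fin (k + 3)), s ≠ 0 →
      G s = setInd (stairSet b) → G 0 = setInd T →
      (∀ i, i ≠ s → i ≠ 0 → ∃ a, IsStair m a ∧ G i = setInd (stairSet a)) →
      sahiE (gridWeight m) (k + 3) G ≤ 0 := by
    intro G s hs0 hGs hG0 hGrest
    obtain ⟨s', rfl⟩ := Fin.exists_succ_eq.2 hs0
    -- every slot of the tail is a staircase indicator
    have htail : ∀ i : Fin (k + 2), ∃ a, IsStair m a ∧ Fin.tail G i = setInd (stairSet a) := by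
      intro i
      by_cases hi : i = s'
      · exact ⟨b, hb, by rw [hi]; exact hGs⟩
      · exact hGrest i.succ (fun h => hi (Fin.succ_injective _ h)) (Fin.succ_ne_zero i)
    choose a ha haG using htail
    have htailEq : Fin.tail G = fun i => setInd (stairSet (a i)) := funext haG
    rw [sahiE_succ_succ]
    have hlast : 0 ≤ sahiE (gridWeight m) (k + 2) (Fin.tail G) * ex (gridWeight m) (G 0) := by
      refine mul_nonneg ?_ ?_
      · rw [htailEq]; exact hC a ha
      · rw [hG0]; exact ex_nonneg hμ fun x => setInd_nonneg _ _
    have hterms : ∀ i : Fin (k + 2),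
        sahiE (gridWeight m) (k + 2) (update (Fin.tail G) i (Fin.tail G i * G 0)) ≤ 0 := by
      intro i
      by_cases hi : i = s'
      · -- the slot of `χ_b`: `χ_b χ_S = 0`
        subst hi
        have hzero : Fin.tail G i * G 0 = 0 := by
          rw [show Fin.tail G i = G i.succ from rfl, hGs, hG0, setInd_mul,
            Finset.disjoint_iff_inter_eq_empty.1 hbT, setInd_empty_eq_zero]
        rw [hzero, sahiE_update_zero]
      · -- a staircase slot: `χ_{a^i} χ_S = χ_{S_{a^i} ∩ S}`, apply `A(n−1)` with the new set in slot `i`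
        have hprod : Fin.tail G i * G 0 = setInd (stairSet (a i) ∩ T) := by
          rw [haG i, hG0, setInd_mul]
        rw [hprod]
        refine hA _ s' i (Ne.symm hi) b (stairSet (a i) ∩ T) hb ?_ ?_ ?_ ?_
        · exact Finset.disjoint_of_subset_right Finset.inter_subset_right hbT
        · rw [update_of_ne (Ne.symm hi)]
          exact hGs
        · rw [update_self]
        · intro j hjs hji
          refine ⟨a j, ha j, ?_⟩
          rw [update_of_ne hji]
          exact haG j
    have hsum : ∑ i : Fin (k + 2), sahiE (gridWeight m) (k + 2) (update (Fin.tail G) i (Fin.tail G i * G 0)) ≤ 0 :=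
      sum_nonpos fun i _ => hterms i
    linarith
  -- General position of `t`: move it to slot `0` by the transposition `(0 t)`.
  let σ : Equiv.Perm (Fin (k + 3)) := Equiv.swap t 0
  have hσ0 : σ 0 = t := Equiv.swap_apply_right _ _
  have hσt : σ t = 0 := Equiv.swap_apply_left _ _
  rw [← sahiE_comp_perm (gridWeight m) (k + 3) σ F]
  refine main (fun i => F (σ i)) (σ s) ?_ ?_ ?_ ?_
  · intro h
    apply hst
    have := congrArg σ h
    rwa [Equiv.swap_apply_self, hσ0] at this
  · show F (σ (σ s)) = _
    rw [Equiv.swap_apply_self]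
    exact hs
  · show F (σ 0) = _
    rw [hσ0]
    exact ht
  · intro i his hi0
    refine hrest (σ i) (fun h => his ?_) (fun h => hi0 ?_)
    · rw [← h, Equiv.swap_apply_self]
    · have h' := congrArg σ h
      rwa [Equiv.swap_apply_self, hσt] at h'

/-! ### Theorem 3.12 (`A(n) ⟹ B(n)`): starring the sequence with the larger entry -/

/-- `χ_{c⋆} = χ_c + χ_{S_{c⋆} ∖ S_c}` (the set `S` of the proof of Thm. 3.12). [cite: LiebSahi2021, Thm. 3.12 (proof)] -/
theorem setInd_stairSet_aStar {c : Fin m → ℕ} {p : ℕ} (hp : p + 1 < m) :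
    setInd (stairSet (aStar c hp)) = setInd (stairSet c) + setInd (stairSet (aStar c hp) \ stairSet c) := by
  classical
  have hsub : stairSet c ⊆ stairSet (aStar c hp) := by
    refine stairSet_mono fun j => ?_
    unfold aStar
    by_cases hj : j = ixR hp
    · subst hj; rw [update_self]; exact Nat.le_succ _
    · rw [update_of_ne hj]
  funext x
  simp only [Pi.add_apply, setInd_apply, Finset.mem_sdiff]
  by_cases hx : x ∈ stairSet c
  · simp [hx, hsub hx]
  · by_cases hx' : x ∈ stairSet (aStar c hp) <;> simp [hx, hx']

/-- **Theorem 3.12** from `A(n)`: if `b = a^j` and `c = a^l` (`j ≠ l`) both have descent at `i` and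
`b_{i+1} ≤ c_{i+1}`, then replacing `c` by `c⋆` does not increase `E_n` — because `χ_{c⋆} − χ_c = χ_S` with
`χ_S χ_b = χ_{c⋆ b} − χ_{cb} = 0` (Lemma 2.7) and `A(n)`. [cite: LiebSahi2021, Thm. 3.12 (proof "A(n) ⟹ B(n)") and Lemma 2.7] -/
theorem sahiE_update_aStar_le {n : ℕ}
    (hA : ∀ (F : Fin n → Fin m × Fin m → ℝ) (s t : Fin n), s ≠ t → ∀ (b : Fin m → ℕ)
      (T : Finset (Fin m × Fin m)), IsStair m b → Disjoint (stairSet b) T → F s = setInd (stairSet b) →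
      F t = setInd T → (∀ i, i ≠ s → i ≠ t → ∃ a, IsStair m a ∧ F i = setInd (stairSet a)) →
      sahiE (gridWeight m) n F ≤ 0)
    {a : Fin n → Fin m → ℕ} (ha : ∀ i, IsStair m (a i)) {j l : Fin n} (hjl : j ≠ l) {p : ℕ} (hp : p + 1 < m)
    (hle : a j (ixR hp) ≤ a l (ixR hp)) :
    sahiE (gridWeight m) n (update (fun i => setInd (stairSet (a i))) l (setInd (stairSet (aStar (a l) hp)))) ≤
      sahiE (gridWeight m) n (fun i => setInd (stairSet (a i))) := by
  classical
  set f : Fin n → Fin m × Fin m → ℝ := fun i => setInd (stairSet (a i)) with hf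
  have hself : update f l (setInd (stairSet (a l))) = f := by rw [hf, update_eq_self]
  rw [setInd_stairSet_aStar hp, sahiE_update_add, hself, add_le_iff_nonpos_right]
  refine hA _ j l hjl (a j) (stairSet (aStar (a l) hp) \ stairSet (a l)) (ha j) ?_ ?_ ?_ ?_
  · -- Lemma 2.7: `S_{c⋆} ∩ S_b = S_c ∩ S_b`, so `S_b` misses `S_{c⋆} ∖ S_c`
    rw [Finset.disjoint_left]
    intro x hxb hxD
    rw [Finset.mem_sdiff] at hxD
    have hx : x ∈ stairSet (aStar (a l) hp) ∩ stairSet (a j) := Finset.mem_inter.2 ⟨hxD.1, hxb⟩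
    rw [← stairSet_inf, aStar_inf_eq hp hle, stairSet_inf] at hx
    exact hxD.2 (Finset.mem_inter.1 hx).1
  · rw [update_of_ne hjl]
  · rw [update_self]
  · intro i hij hil
    exact ⟨a i, ha i, by rw [update_of_ne hil]⟩

/-! ### Theorem 3.13 (`B(n) ⟹ C(n)`): the extremal argument -/

open Classical in
/-- `𝒜(m)` is the finite set of `IsStair` members of `{0,…,m}^m` (plumbing for the extremal argument; as in
`UniformSquare.lean`). [folklore] -/
private theorem mem_stairFinset {a : Fin m → ℕ} :
    a ∈ (Fintype.piFinset fun _ : Fin m => Finset.range (m + 1)).filter (IsStair m) ↔ IsStair m a := by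
  rw [Finset.mem_filter, Fintype.mem_piFinset]
  constructor
  · exact fun h => h.2
  · exact fun h => ⟨fun i => Finset.mem_range.2 (Nat.lt_succ_of_le (h.2 i)), h⟩

/-- Nested staircases of constant sequences: `S_{(c,…,c)} ⊆ S_{(c',…,c')}` or conversely.
[cite: LiebSahi2021, Prop. 3.9 (constant sequences)] -/
theorem stairSet_const_total (c c' : ℕ) :
    stairSet (fun _ : Fin m => c) ⊆ stairSet (fun _ : Fin m => c') ∨
      stairSet (fun _ : Fin m => c') ⊆ stairSet (fun _ : Fin m => c) := by
  rcases le_total c c' with h | h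
  · exact Or.inl (stairSet_mono fun _ => h)
  · exact Or.inr (stairSet_mono fun _ => h)

/-- **The step `B(n) ⟹ C(n)`** (with `A(n)` as input, `B(n)` being `sahiE_update_aStar_le`): Lieb–Sahi's
extremal argument.  Among the `n`-tuples of staircases minimising `E_n`, take one maximising
`E(a^1) + ⋯ + E(a^n)`; if some `a^k` had a descent at `i`, then either no other sequence has one there and
`a⁺` is a minimiser with a larger sum (Prop. 3.10), or some `b = a^j` has and starring the sequence with the
larger `(i+1)`-entry gives a minimiser with a larger sum (Thm. 3.12) — contradiction; so all `a^k` are constant,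
the `S_{a^k}` are nested, and `E_n ≥ 0` there (Prop. 3.9, the chain case). [cite: LiebSahi2021, Thm. 3.13 (proof "B(n) ⟹ C(n)") and Prop. 3.9] -/
theorem stairPos_of_disjointNonpos (hm : 0 < m) {n : ℕ}
    (hA : ∀ (F : Fin n → Fin m × Fin m → ℝ) (s t : Fin n), s ≠ t → ∀ (b : Fin m → ℕ)
      (T : Finset (Fin m × Fin m)), IsStair m b → Disjoint (stairSet b) T → F s = setInd (stairSet b) →
      F t = setInd T → (∀ i, i ≠ s → i ≠ t → ∃ a, IsStair m a ∧ F i = setInd (stairSet a)) →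
      sahiE (gridWeight m) n F ≤ 0)
    (a : Fin n → Fin m → ℕ) (ha : ∀ i, IsStair m (a i)) :
    0 ≤ sahiE (gridWeight m) n (fun i => setInd (stairSet (a i))) := by
  classical
  -- the functionals `E_n` and `λ` on `𝒜^n`
  set E : (Fin n → Fin m → ℕ) → ℝ := fun x => sahiE (gridWeight m) n (fun i => setInd (stairSet (x i)))
    with hE
  set Λ : (Fin n → Fin m → ℕ) → ℝ := fun x => ∑ i, S (x i) with hΛ
  set 𝒯 : Finset (Fin n → Fin m → ℕ) := Fintype.piFinset fun _ : Fin n =>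
    (Fintype.piFinset fun _ : Fin m => Finset.range (m + 1)).filter (IsStair m) with h𝒯
  have hmem𝒯 : ∀ x, x ∈ 𝒯 ↔ ∀ i, IsStair m (x i) := by
    intro x
    simp only [h𝒯, Fintype.mem_piFinset, mem_stairFinset]
  have hne : 𝒯.Nonempty := ⟨a, (hmem𝒯 a).2 ha⟩
  obtain ⟨x₀, hx₀, hmin⟩ := 𝒯.exists_min_image E hne
  set 𝒯' := 𝒯.filter (fun x => E x = E x₀) with h𝒯'
  have hne' : 𝒯'.Nonempty := ⟨x₀, by rw [h𝒯', Finset.mem_filter]; exact ⟨hx₀, rfl⟩⟩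
  obtain ⟨x₁, hx₁, hmax⟩ := 𝒯'.exists_max_image Λ hne'
  rw [h𝒯', Finset.mem_filter] at hx₁
  obtain ⟨hx₁𝒯, hx₁E⟩ := hx₁
  have hx₁s : ∀ i, IsStair m (x₁ i) := (hmem𝒯 x₁).1 hx₁𝒯
  have hmin₁ : ∀ y, (∀ i, IsStair m (y i)) → E x₁ ≤ E y := fun y hy => by
    rw [hx₁E]
    exact hmin y ((hmem𝒯 y).2 hy)
  have hmax₁ : ∀ y, (∀ i, IsStair m (y i)) → E y = E x₁ → Λ y ≤ Λ x₁ := fun y hy hyE =>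
    hmax y (by rw [h𝒯', Finset.mem_filter]; exact ⟨(hmem𝒯 y).2 hy, hyE.trans hx₁E⟩)
  -- `E` and `λ` of a family with one slot replaced
  have hEupd : ∀ (l : Fin n) (z : Fin m → ℕ),
      E (update x₁ l z) = sahiE (gridWeight m) n (update (fun i => setInd (stairSet (x₁ i))) l
        (setInd (stairSet z))) := by
    intro l z
    simp only [hE, setInd_stairSet_update]
  have hΛupd : ∀ (l : Fin n) (z : Fin m → ℕ), Λ (update x₁ l z) = Λ x₁ + (S z - S (x₁ l)) := by
    intro l z
    simp only [hΛ, sum_S_update]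
  -- starring a descending sequence whose `(i+1)`-entry dominates another descending one is impossible
  have hstar : ∀ (j l : Fin n), j ≠ l → ∀ {p : ℕ} (hp : p + 1 < m), HasDescent (x₁ l) hp →
      x₁ j (ixR hp) ≤ x₁ l (ixR hp) → False := by
    intro j l hjl p hp hdl hle
    have hy : ∀ i, IsStair m (update x₁ l (aStar (x₁ l) hp) i) :=
      isStair_update hx₁s l (isStair_aStar hp (hx₁s l) hdl)
    have hEy : E (update x₁ l (aStar (x₁ l) hp)) ≤ E x₁ := by
      rw [hEupd]
      exact sahiE_update_aStar_le hA hx₁s hjl hp hle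
    have hEy' : E (update x₁ l (aStar (x₁ l) hp)) = E x₁ := le_antisymm hEy (hmin₁ _ hy)
    have hΛy := hmax₁ _ hy hEy'
    rw [hΛupd, S_aStar] at hΛy
    linarith
  -- no component of the extremal family has a descent
  have hnd : ∀ (l : Fin n) (p : ℕ) (hp : p + 1 < m), ¬ HasDescent (x₁ l) hp := by
    intro l p hp hdl
    by_cases hex : ∃ j, j ≠ l ∧ HasDescent (x₁ j) hp
    · -- two sequences with descent at `p` [Thm. 3.12]
      obtain ⟨j, hjl, hdj⟩ := hex
      rcases le_total (x₁ j (ixR hp)) (x₁ l (ixR hp)) with hle | hle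
      · exact hstar j l hjl hp hdl hle
      · exact hstar l j (Ne.symm hjl) hp hdj hle
    · -- only `x₁ l` has descent at `p` [Prop. 3.10]
      push Not at hex
      have hflat : ∀ i, i ≠ l → x₁ i (ixL hp) = x₁ i (ixR hp) := fun i hi =>
        eq_of_not_hasDescent (hx₁s i).1 hp (hex i hi)
      have havg := sahiE_update_aPlus_add_aMinus hx₁s l hp hflat
      rw [← hEupd, ← hEupd] at havg
      have hyP : ∀ i, IsStair m (update x₁ l (aPlus (x₁ l) hp) i) :=
        isStair_update hx₁s l (isStair_aPlus hp (hx₁s l))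
      have hyM : ∀ i, IsStair m (update x₁ l (aMinus (x₁ l) hp) i) :=
        isStair_update hx₁s l (isStair_aMinus hp (hx₁s l))
      have hP := hmin₁ _ hyP
      have hM := hmin₁ _ hyM
      have heq : E (update x₁ l (aPlus (x₁ l) hp)) = E x₁ := by
        have hEx : E x₁ = sahiE (gridWeight m) n (fun i => setInd (stairSet (x₁ i))) := rfl
        rw [← hEx] at havg
        linarith
      have hΛy := hmax₁ _ hyP heq
      rw [hΛupd, S_aPlus] at hΛy
      have hd' : (x₁ l (ixR hp) : ℝ) < x₁ l (ixL hp) := by exact_mod_cast hdl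
      linarith
  -- hence every component is constant, the staircases are nested, and `E_n ≥ 0` there [Prop. 3.9]
  have hconst : ∀ l, x₁ l = fun _ => x₁ l ⟨0, hm⟩ := fun l =>
    eq_const_of_forall_not_hasDescent hm (hx₁s l).1 (hnd l)
  have hpos : 0 ≤ E x₁ := by
    have hfam : (fun i => setInd (stairSet (x₁ i))) =
        fun i => setInd (stairSet (fun _ : Fin m => x₁ i ⟨0, hm⟩)) := by
      funext i
      rw [← hconst i]
    change 0 ≤ sahiE (gridWeight m) n (fun i => setInd (stairSet (x₁ i)))
    rw [hfam]
    exact sahiE_setInd_nonneg_of_total (isFKGMeasure_gridWeight hm).nonneg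
      (isFKGMeasure_gridWeight hm).sum_eq_one _ fun i j => stairSet_const_total _ _
  exact hpos.trans (hmin₁ a ha)

/-! ### The induction, and Theorems 3.11–3.13 -/

/-- **The joint induction of [LiebSahi2021, §3.4]**: for every `k`, `A(k+2)` (in symmetric form) and `C(k+2)`
hold — `A(n−1) ∧ C(n−1) ⟹ A(n)` and `A(n) ⟹ B(n) ⟹ C(n)`. [cite: LiebSahi2021, Thms. 3.11–3.13 (proof)] -/
theorem disjointNonpos_and_stairPos (hm : 0 < m) : ∀ k : ℕ,
    (∀ (F : Fin (k + 2) → Fin m × Fin m → ℝ) (s t : Fin (k + 2)), s ≠ t → ∀ (b : Fin m → ℕ)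
      (T : Finset (Fin m × Fin m)), IsStair m b → Disjoint (stairSet b) T → F s = setInd (stairSet b) →
      F t = setInd T → (∀ i, i ≠ s → i ≠ t → ∃ a, IsStair m a ∧ F i = setInd (stairSet a)) →
      sahiE (gridWeight m) (k + 2) F ≤ 0) ∧
    (∀ a : Fin (k + 2) → Fin m → ℕ, (∀ i, IsStair m (a i)) →
      0 ≤ sahiE (gridWeight m) (k + 2) (fun i => setInd (stairSet (a i))))
  | 0 => by
    have hA : ∀ (F : Fin 2 → Fin m × Fin m → ℝ) (s t : Fin 2), s ≠ t → ∀ (b : Fin m → ℕ)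
        (T : Finset (Fin m × Fin m)), IsStair m b → Disjoint (stairSet b) T → F s = setInd (stairSet b) →
        F t = setInd T → (∀ i, i ≠ s → i ≠ t → ∃ a, IsStair m a ∧ F i = setInd (stairSet a)) →
        sahiE (gridWeight m) 2 F ≤ 0 :=
      fun F s t hst b T _ hbT hs ht _ => disjoint_nonpos_zero F s t hst b T hbT hs ht
    exact ⟨hA, stairPos_of_disjointNonpos hm hA⟩
  | k + 1 => by
    obtain ⟨hA, hC⟩ := disjointNonpos_and_stairPos hm k
    have hA' := disjoint_nonpos_succ k hC hA
    exact ⟨hA', stairPos_of_disjointNonpos hm hA'⟩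

/-- **Theorem 3.13** [LiebSahi2021]: for the uniform probability weight on the `m × m` grid (`m ≥ 1`),
`E_n(χ_{a^1},…,χ_{a^n}) ≥ 0` for every `n` and all staircases `a^1,…,a^n ∈ 𝒜(m)`.
[cite: LiebSahi2021, Thm. 3.13] -/
theorem liebSahi_thm313 (hm : 0 < m) : ∀ (n : ℕ) (a : Fin n → Fin m → ℕ), (∀ i, IsStair m (a i)) →
    0 ≤ sahiE (gridWeight m) n (fun i => setInd (stairSet (a i)))
  | 0, a, _ => by rw [sahiE_zero]
  | 1, a, _ => by
    rw [sahiE_one_apply]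
    exact ex_nonneg (isFKGMeasure_gridWeight hm).nonneg fun x => setInd_nonneg _ _
  | k + 2, a, ha => (disjointNonpos_and_stairPos hm k).2 a ha

/-- **Theorem 3.11** [LiebSahi2021] (slots of `χ_b`, `χ_S` in arbitrary positions `s ≠ t`): if `a^i` (`i ≠ s, t`)
and `b` are staircases, `S ⊆ Q_2` is ANY subset of the grid and `χ_b χ_S = 0`, then
`E_n(χ_{a^1},…,χ_b,…,χ_S,…) ≤ 0` (uniform weight, `m ≥ 1`, `n ≥ 2`). [cite: LiebSahi2021, Thm. 3.11] -/
theorem liebSahi_thm311 (hm : 0 < m) {k : ℕ} (F : Fin (k + 2) → Fin m × Fin m → ℝ) {s t : Fin (k + 2)}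
    (hst : s ≠ t) {b : Fin m → ℕ} {T : Finset (Fin m × Fin m)} (hb : IsStair m b)
    (hbT : Disjoint (stairSet b) T) (hs : F s = setInd (stairSet b)) (ht : F t = setInd T)
    (hrest : ∀ i, i ≠ s → i ≠ t → ∃ a, IsStair m a ∧ F i = setInd (stairSet a)) :
    sahiE (gridWeight m) (k + 2) F ≤ 0 :=
  (disjointNonpos_and_stairPos hm k).1 F s t hst b T hb hbT hs ht hrest

/-- **Theorem 3.12** [LiebSahi2021] (slots in arbitrary positions `j ≠ l`): if `b = a^j` and `c = a^l` have
descent at `i` and `b_{i+1} ≤ c_{i+1}`, then `E_n(…, b, …, c⋆, …) ≤ E_n(…, b, …, c, …)` (uniform weight,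
`m ≥ 1`; only the descent of `c` is needed). [cite: LiebSahi2021, Thm. 3.12] -/
theorem liebSahi_thm312 (hm : 0 < m) {n : ℕ} {a : Fin n → Fin m → ℕ} (ha : ∀ i, IsStair m (a i))
    {j l : Fin n} (hjl : j ≠ l) {p : ℕ} (hp : p + 1 < m) (hle : a j (ixR hp) ≤ a l (ixR hp)) :
    sahiE (gridWeight m) n (fun i => setInd (stairSet (update a l (aStar (a l) hp) i))) ≤
      sahiE (gridWeight m) n (fun i => setInd (stairSet (a i))) := by
  rw [setInd_stairSet_update]
  rcases Nat.lt_or_ge n 2 with hn | hn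
  · -- `n ≤ 1` cannot hold two distinct slots
    exfalso
    have : Subsingleton (Fin n) := by
      rcases Nat.lt_succ_iff.1 hn |> Nat.lt_or_eq_of_le with h | h
      · have h0 : n = 0 := by omega
        subst h0; infer_instance
      · subst h; infer_instance
    exact hjl (Subsingleton.elim j l)
  · obtain ⟨k, rfl⟩ := Nat.exists_eq_add_of_le' hn
    exact sahiE_update_aStar_le (disjointNonpos_and_stairPos hm k).1 ha hjl hp hle

/-! ### Transport: down-sets, up-sets, and Sahi positivity of every order -/

/-- `E_n ≥ 0` for the indicators of any `n` DOWN-sets of the grid, uniform weight (every down-set is a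
staircase — "any monotone union of `D_{i,j}` is of this form"). [cite: LiebSahi2021, Thm. 3.13 with Lemma 3.8] -/
theorem sahiE_setInd_nonneg_of_isLowerSet_grid (hm : 0 < m) {n : ℕ} (L : Fin n → Finset (Fin m × Fin m))
    (hL : ∀ i, IsLowerSet ((L i : Finset (Fin m × Fin m)) : Set (Fin m × Fin m))) :
    0 ≤ sahiE (gridWeight m) n (fun i => setInd (L i)) := by
  choose a ha haL using fun i => exists_stair_eq_of_isLowerSet (L i) (hL i)
  have hfam : (fun i => setInd (L i)) = fun i => setInd (stairSet (a i)) := by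
    funext i
    rw [haL i]
  rw [hfam]
  exact liebSahi_thm313 hm n a ha

/-- The same for `n` UP-sets, by the order-reversing reflection of the grid (Lieb–Sahi's `x_i ↦ 1 − x_i`).
[cite: LiebSahi2021, Thm. 3.7 and §2 (before Thm. 2.1)] -/
theorem sahiE_setInd_nonneg_of_isUpperSet_grid (hm : 0 < m) {n : ℕ} (U : Fin n → Finset (Fin m × Fin m))
    (hU : ∀ i, IsUpperSet ((U i : Finset (Fin m × Fin m)) : Set (Fin m × Fin m))) :
    0 ≤ sahiE (gridWeight m) n (fun i => setInd (U i)) := by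
  classical
  let L : Finset (Fin m × Fin m) → Finset (Fin m × Fin m) := fun V => univ.filter fun x => gridRev m x ∈ V
  have hL : ∀ i, IsLowerSet ((L (U i) : Finset (Fin m × Fin m)) : Set (Fin m × Fin m)) := by
    intro i x y hyx hx
    rw [Finset.mem_coe, Finset.mem_filter] at hx ⊢
    exact ⟨mem_univ _, hU i (gridRev_antitone hyx) hx.2⟩
  have hind : ∀ V : Finset (Fin m × Fin m), setInd V ∘ gridRev m = setInd (L V) := by
    intro V
    funext x
    simp only [Function.comp_apply, setInd_apply, L, Finset.mem_filter, Finset.mem_univ, true_and]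
  have key := sahiE_comp_equiv (gridRev m) (gridWeight m) n (fun i => setInd (U i))
  have hμ : gridWeight m ∘ gridRev m = gridWeight m := rfl
  have hf : (fun i => (fun i => setInd (U i)) i ∘ gridRev m) = fun i => setInd (L (U i)) := by
    funext i
    exact hind (U i)
  rw [← key, hμ, hf]
  exact sahiE_setInd_nonneg_of_isLowerSet_grid hm (fun i => L (U i)) hL

/-- **Lieb–Sahi's Theorem 3.7, discrete form: the uniform weight on the square grid is Sahi-positive of EVERY
order.**  For all `m ≥ 1` and all `n`, `E_n(f_1,…,f_n) ≥ 0` for all nonnegative monotone `f_1,…,f_n` on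
`Fin m × Fin m` under the uniform probability weight — Theorem 3.13 plus the layer cake (Lemmas 2.2/3.8) and the
reflection; the passage to Lebesgue measure on `[0,1]²` (an `L¹` limit, Lemmas 2.3/3.8) is not formalised.
(Order `3` is `UniformSquare.sahiPositive_three_uniformGrid`.) [cite: LiebSahi2021, Thm. 3.7 (via Lemma 3.8 and Thm. 3.13)] -/
theorem sahiPositive_uniformGrid (hm : 0 < m) (n : ℕ) : SahiPositive (gridWeight m) n := by
  classical
  rw [sahiPositive_iff_indicators]
  intro U hU
  exact sahiE_setInd_nonneg_of_isUpperSet_grid hm U hU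

end LiebSahiGrid

end Literature.Combinatorics.Sahi2008
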